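import Mathlib
import HarnessLib
import Summits.HubbardSuperconductivity.HubbardSuperconductivity.Theorems.KLProgrammeKLRegimeEnginePairTransferMemberTower
import Summits.HubbardSuperconductivity.HubbardSuperconductivity.Theorems.KLProgrammeKLRegimeEnginePairTransferMemberDefectRowsMasses
import Summits.HubbardSuperconductivity.HubbardSuperconductivity.Theorems.KLProgrammeKLRegimeEnginePairTransferMemberStart
import Summits.HubbardSuperconductivity.HubbardSuperconductivity.Theorems.KLProgrammeKLRegimeEnginePairTransferMemberRateVariation

/-!
# Route `KLProgramme` — ENGINE (stmt-HubbardSuperconductivity-20437 `KLRegimeEngineV17F2`), row (c) binder #8: the PLAIN member's resolvent-tower package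
# `htower` FROM hsucc-SHAPED ROWS IN MASSES FORM — **`klmt_htower_family_masses`**
# (cell gate-hubbard-kl, seat hubbard-kl-k3c1-p1 g25, technique «composed-map remainder propagation»; item «ROW-(c)-LADSZ-MASSES»; sequel of
# `klmt_htower_plain` (…MemberTower, g24) ∘ `klmd_defect_le_masses_family` (…MemberDefectRowsMasses, g13) ∘ `klmf_integral_norm_rate_le_klRungProfile` (…RateVariation))

WHY.  Binder #8 of the pin of record (`hexLadSz`, …ClosersVGQLadTower) hands the plain member's tower SIZES with three OPAQUE data: an integrated rate profile `ρ`
(`∫₀¹‖ḃ‖ ≤ ρ`, `(3/2)m·Σρ ≤ 1/3`), the RESOLVED source integral `I ≥ ∫₀¹‖(Ȧ + A·diag ḃ·A)(t)(x,y)‖dt` and the majorant `Ea ≥ FT_ρ[I] + FT_w[η]`.  All three are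
consequences of landed doors:
* `ρ := klRungProfile … n (s_(n+1,n+1)) Qm` BY NAME — `klmf_integral_norm_rate_le_klRungProfile` (the rate row) and `sum_klRungProfile_compl_le` (`Σρ ≤ 738288`), so the
  smallness row is the scalar `(3/2)·m·738288 ≤ 1/3` (`hm7`; at `G = klEngGeo14` it follows from `m·bhi/4 ≤ 1/3`);
* `I` from the member's Riccati defect RESOLVED BY NAME (`klmd_pinnedDefect_eq_resolved`) in MASSES form — `klmd_defect_le_masses_family` at the family member `j = n+1`
  (which IS the plain member: `softSymbolCompl_self`): `‖S(t)(x,y)‖ ≤ (Λₙ−Λₙ₊₁)(½RH(x,y) + (βL²)⁻³(M4²·Wd(x,y) + M4²·Wx(x,y) + 2·M6M2·W6)) + RL(x,y)` pointwise in `t`, hence the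
  integral row (`intervalIntegral.norm_integral_le_of_norm_le_const`);
* `Ea` WRITTEN OUT; the (F)(i) start row in MODEL form (the re-framed history member, `klmf_memberCurve_zero_eq`).
So **`klmt_htower_family_masses`** concludes the fourteen-conjunct `htower` of `EngineV8.pairLadderStepAtV17F2_of_relFamilyK5(_klCT8)` (generic bar `Tb`, slot `Bar`) — the
SAME conclusion as `klmt_htower_plain` — from the FAMILY pins of h5g″'s `hsucc` (`A A′ b b′ ρ V V6 Sg Hd Φ Wd Br`, equations text-identical) and, per in-class `Qm`, the rows AT
`j = n+1`: a priori along the slice · history a priori · (F)(i) model row + cap · smallness of the named weight · kernel sups `0 ≤ M4`, `M4 M6 M2` · the `RH₁`/`RL₁` class rows ·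
the three plain-member weight masses `Wd Wx W6` · consumer rows (`Tb ≤ r′`, `FT_ρ[J] + FT_w[η] + FT_w[Tb] ≤ E₁ ≤ e₁ ≤ Bar`).
Plumbing + real analysis over landed doors; every row is a HYPOTHESIS of its owner (class #1 / (c) closer / k3c2-p2); nothing here asserts (c), any open row of 20437, K3, U₀,
the window or superconductivity.  0 kit · 0 lit.
-/

noncomputable section

namespace Summit.HubbardSuperconductivity.HubbardSuperconductivity.Theorems.KLRegimeSplit

set_option linter.dupNamespace false -- summit = problem name (single-conjunct summit), D-0017

open Finset Matrix Set Literature.MathematicalPhysics.QuantumLattice Literature.Probability.LatticeModels GrassmannAlgebra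
open Summit.HubbardSuperconductivity.HubbardSuperconductivity.Theorems.KLProgrammeLegKernels
open Summit.HubbardSuperconductivity.HubbardSuperconductivity.Theorems.TwoPointAssembly
open Summit.HubbardSuperconductivity.HubbardSuperconductivity.Theorems.DispersionFlow
open Summit.HubbardSuperconductivity.HubbardSuperconductivity.Theorems.KLRegimeWick
open Summit.HubbardSuperconductivity.HubbardSuperconductivity.Theorems.EngineV8

/-! ## §0 Scalar bookkeeping -/

/-- Monotonicity of the masses-form majorant in its three weight masses. -/
theorem klmt_masses_mono {Λd c3 RH RL M44 M62 Sd Sx S6 Wd Wx W6 : ℝ} (hΛ : 0 ≤ Λd) (hc : 0 ≤ c3) (h4 : 0 ≤ M44) (h6 : 0 ≤ M62)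
    (hd : Sd ≤ Wd) (hx : Sx ≤ Wx) (h6' : S6 ≤ W6) :
    Λd * (2⁻¹ * RH + c3 * (M44 * Sd + M44 * Sx + 2 * (M62 * S6))) + RL ≤ Λd * (2⁻¹ * RH + c3 * (M44 * Wd + M44 * Wx + 2 * (M62 * W6))) + RL := by
  have h1 : M44 * Sd + M44 * Sx + 2 * (M62 * S6) ≤ M44 * Wd + M44 * Wx + 2 * (M62 * W6) := by nlinarith
  nlinarith [mul_le_mul_of_nonneg_left (mul_le_mul_of_nonneg_left h1 hc) hΛ]

/-- A `t`-uniform pointwise bound integrates over `[0,1]` (no integrability needed). -/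
theorem klmt_integral_norm_le_of_forall {F : ℝ → ℂ} {C : ℝ} (h : ∀ t ∈ Icc (0 : ℝ) 1, ‖F t‖ ≤ C) : (∫ t in (0 : ℝ)..1, ‖F t‖) ≤ C := by
  have h2 : ‖∫ t in (0 : ℝ)..1, ‖F t‖‖ ≤ C * |1 - 0| :=
    intervalIntegral.norm_integral_le_of_norm_le_const fun t ht => by
      rw [Set.uIoc_of_le zero_le_one] at ht
      rw [Real.norm_eq_abs, abs_norm]; exact h t ⟨ht.1.le, ht.2⟩
  rw [sub_zero, abs_one, mul_one, Real.norm_eq_abs] at h2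
  exact (le_abs_self _).trans h2

variable (L M : ℕ) [NeZero L] [NeZero M]

set_option maxHeartbeats 3200000 in -- long pinning equations (h5g″'s hsucc pins) + fourteen-conjunct package; plumbing only
/-- **`klmt_htower_family_masses`** — the `htower` package (keying `(n, n+1)`, generic bar `Tb` / slot `Bar`) of the PLAIN member from hsucc-shaped rows in MASSES form
(module docstring).  `hm7` is the scalar smallness of the a-priori size against the rung profile's total mass `738288`. -/
theorem klmt_htower_family_masses {β U μ : ℝ} {n N : ℕ} {m : ℝ} (hm : 0 ≤ m) (hm7 : 3 / 2 * m * 738288 ≤ 1 / 3) {Rn : RenConsts} {G : GeoConsts}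
    (hK : FrameOK Rn U N μ (klFlowFrameU L M β U μ (n + 1))) (hβ : klBetaMin ≤ β) (hβL : β ≤ L) (hG : (2 : ℝ) ^ 19 ≤ G.bhi)
    (hZ : ∀ Λ ∈ Icc (klScale klE0 (n + 1)) (klScale klE0 n), hubbardEffPartitionFnCT L M β U μ 0 (klFlowFrameU L M β U μ (n + 1)) Λ ≠ 0)
    (A A' : ℕ → TorusSite 2 L → ℝ → Matrix (TorusSite 2 L) (TorusSite 2 L) ℂ) (b b' : ℕ → TorusSite 2 L → ℝ → TorusSite 2 L → ℂ)
    (ρ : ℕ → TorusSite 2 L → TorusSite 2 L → ℝ) (V : ℕ → ℝ → (Fin 4 → HubbardFieldIdx L M) → ℂ) (V6 : ℕ → ℝ → (Fin 6 → HubbardFieldIdx L M) → ℂ)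
    (Sg : ℕ → ℝ → FreqMomentum L M → Fin 2 → ℂ) (Hd : ℕ → ℝ → (Fin 4 → HubbardFieldIdx L M) → ℂ) (Φ : ℕ → ℝ → FreqMomentum L M → ℝ) (Wd : ℝ → FreqMomentum L M → ℝ)
    (Br : ℕ → TorusSite 2 L → ℝ → TorusSite 2 L × MatsubaraIdx M → ℂ)
    (hAdef : A = fun j Qm t => Matrix.of fun k k' : TorusSite 2 L => if k ∈ klBall L μ 0 ∧ k' ∈ klBall L μ 0 then vertexFn L M β (gaussConv ℂ (softCovOf L M β μ (klFlowFrameU L M β U μ (n + 1)) (softSymbolCompl L M β μ (klFlowFrameU L M β U μ (n + 1)) (n + 1) j) + hubbardCovAboveCT L M β μ 0 (klFlowFrameU L M β U μ (n + 1)) (klScale klE0 (n + 1)) - hubbardCovAboveCT L M β μ 0 (klFlowFrameU L M β U μ (n + 1)) (klScale klE0 n + t * (klScale klE0 (n + 1) - klScale klE0 n))) (hubbardEffectiveActionCT L M β U μ 0 (klFlowFrameU L M β U μ (n + 1)) (klScale klE0 n + t * (klScale klE0 (n + 1) - klScale klE0 n)))) 4 ![(((omega0 M, k'), 0), 0), ((((omega0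 M).rev, Qm - k'), 1), 0), ((((omega0 M).rev, Qm - k), 1), 1), (((omega0 M, k), 0), 1)] else 0)
    (hA'def : A' = fun j Qm t => Matrix.of fun k k' : TorusSite 2 L => if k ∈ klBall L μ 0 ∧ k' ∈ klBall L μ 0 then (klScale klE0 (n + 1) - klScale klE0 n) • -((2 : ℂ)⁻¹ * vertexFn L M β (gaussConv ℂ (softCovOf L M β μ (klFlowFrameU L M β U μ (n + 1)) (softSymbolCompl L M β μ (klFlowFrameU L M β U μ (n + 1)) (n + 1) j) + hubbardCovAboveCT L M β μ 0 (klFlowFrameU L M β U μ (n + 1)) (klScale klE0 (n + 1)) - hubbardCovAboveCT L M β μ 0 (klFlowFrameU L M β U μ (n + 1)) (klScale klE0 n + t * (klScale klE0 (n + 1) - klScale klE0 n))) (grassmannDerivPairing ℂ (Matrix.of fun X Y : HubbardFieldIdx L M => deriv (fun Λ'' : ℝ => hubbardCovAboveCT L M β μ 0 (klFlowFrameU L M β U μ (n + 1)) Λ'' X Y) (klScale klE0 n + t * (klScale klE0 (n + 1) - klScale klE0 n))) (hubbardEffectiveActionCT L M β U μ 0 (klFlowFrameU L M β U μ (n + 1))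 (klScale klE0 n + t * (klScale klE0 (n + 1) - klScale klE0 n))) (hubbardEffectiveActionCT L M β U μ 0 (klFlowFrameU L M β U μ (n + 1)) (klScale klE0 n + t * (klScale klE0 (n + 1) - klScale klE0 n))))) 4 ![(((omega0 M, k'), 0), 0), ((((omega0 M).rev, Qm - k'), 1), 0), ((((omega0 M).rev, Qm - k), 1), 1), (((omega0 M, k), 0), 1)]) else 0)
    (hbdef : b = fun j Qm t p => -((klBubbleMass L M β μ (klFlowFrameU L M β U μ (n + 1)) (fun k => (softSymbolCompl L M β μ (klFlowFrameU L M β U μ (n + 1)) (n + 1) j) k + (hubbardCutoffWeightCT L M β μ (klFlowFrameU L M β U μ (n + 1)) (klScale klE0 (n + 1)) k - hubbardCutoffWeightCT L M β μ (klFlowFrameU L M β U μ (n + 1)) (klScale klE0 n + t * (klScale klE0 (n + 1) - klScale klE0 n)) k)) (fun k => (softSymbolCompl L M β μ (klFlowFrameU L M β U μ (n + 1)) (n + 1) j) k + (hubbardCutoffWeightCT L M β μ (klFlowFrameU L M β U μ (n + 1)) (klScale klE0 (n + 1)) k - hubbardCutoffWeightCT L M β μ (klFlowFrameU L M β U μ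 (n + 1)) (klScale klE0 n + t * (klScale klE0 (n + 1) - klScale klE0 n)) k)) Qm p : ℝ) : ℂ))
    (hb'def : b' = fun j Qm t p => (((klScale klE0 (n + 1) - klScale klE0 n) * (klBubbleMass L M β μ (klFlowFrameU L M β U μ (n + 1)) (fun k => deriv (fun Λ' => hubbardCutoffWeightCT L M β μ (klFlowFrameU L M β U μ (n + 1)) Λ' k) (klScale klE0 n + t * (klScale klE0 (n + 1) - klScale klE0 n))) (fun k => (softSymbolCompl L M β μ (klFlowFrameU L M β U μ (n + 1)) (n + 1) j) k + (hubbardCutoffWeightCT L M β μ (klFlowFrameU L M β U μ (n + 1)) (klScale klE0 (n + 1)) k - hubbardCutoffWeightCT L M β μ (klFlowFrameU L M β U μ (n + 1)) (klScale klE0 n + t * (klScale klE0 (n + 1) - klScale klE0 n)) k)) Qm p + klBubbleMass L M β μ (klFlowFrameU L M β U μ (n + 1)) (fun k => (softSymbolCompl L M β μ (klFlowFrameU L M β U μ (n + 1)) (n + 1) j) k + (hubbardCutoffWeightCT L M β μ (klFlowFrameU L M β U μ (n + 1)) (klScale klE0 (n + 1)) k - hubbardCutoffWeightCT L M β μ (klFlowFrameU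 L M β U μ (n + 1)) (klScale klE0 n + t * (klScale klE0 (n + 1) - klScale klE0 n)) k)) (fun k => deriv (fun Λ' => hubbardCutoffWeightCT L M β μ (klFlowFrameU L M β U μ (n + 1)) Λ' k) (klScale klE0 n + t * (klScale klE0 (n + 1) - klScale klE0 n))) Qm p) : ℝ) : ℂ))
    (hρdef : ρ = fun j Qm c => klRungProfile L M β μ (klFlowFrameU L M β U μ (n + 1)) n (softSymbolCompl L M β μ (klFlowFrameU L M β U μ (n + 1)) (n + 1) j) Qm c)
    (hV : V = fun j t X => vertexFn L M β (gaussConv ℂ (softCovOf L M β μ (klFlowFrameU L M β U μ (n + 1)) (softSymbolCompl L M β μ (klFlowFrameU L M β U μ (n + 1)) (n + 1) j) + hubbardCovAboveCT L M β μ 0 (klFlowFrameU L M β U μ (n + 1)) (klScale klE0 (n + 1)) - hubbardCovAboveCT L M β μ 0 (klFlowFrameU L M β U μ (n + 1)) (klScale klE0 n + t * (klScale klE0 (n + 1) - klScale klE0 n))) (hubbardEffectiveActionCT L M β U μ 0 (klFlowFrameU L M β U μ (n + 1)) (klScale klE0 n + t * (klScale klE0 (n + 1) - klScale klE0 n))))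 4 X)
    (hV6 : V6 = fun j t X => vertexFn L M β (gaussConv ℂ (softCovOf L M β μ (klFlowFrameU L M β U μ (n + 1)) (softSymbolCompl L M β μ (klFlowFrameU L M β U μ (n + 1)) (n + 1) j) + hubbardCovAboveCT L M β μ 0 (klFlowFrameU L M β U μ (n + 1)) (klScale klE0 (n + 1)) - hubbardCovAboveCT L M β μ 0 (klFlowFrameU L M β U μ (n + 1)) (klScale klE0 n + t * (klScale klE0 (n + 1) - klScale klE0 n))) (hubbardEffectiveActionCT L M β U μ 0 (klFlowFrameU L M β U μ (n + 1)) (klScale klE0 n + t * (klScale klE0 (n + 1) - klScale klE0 n)))) 6 X)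
    (hSg : Sg = fun j t p σ => selfEnergy L M β (gaussConv ℂ (softCovOf L M β μ (klFlowFrameU L M β U μ (n + 1)) (softSymbolCompl L M β μ (klFlowFrameU L M β U μ (n + 1)) (n + 1) j) + hubbardCovAboveCT L M β μ 0 (klFlowFrameU L M β U μ (n + 1)) (klScale klE0 (n + 1)) - hubbardCovAboveCT L M β μ 0 (klFlowFrameU L M β U μ (n + 1)) (klScale klE0 n + t * (klScale klE0 (n + 1) - klScale klE0 n))) (hubbardEffectiveActionCT L M β U μ 0 (klFlowFrameU L M β U μ (n + 1)) (klScale klE0 n + t * (klScale klE0 (n + 1) - klScale klE0 n)))) p σ)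
    (hHd : Hd = fun j t X => vertexFn L M β (dblFold ℂ (grassmannLaplacian ℂ (crossCov ℂ (Matrix.of fun X Y : HubbardFieldIdx L M => deriv (fun Λ' : ℝ => hubbardCovAboveCT L M β μ 0 (klFlowFrameU L M β U μ (n + 1)) Λ' X Y) (klScale klE0 n + t * (klScale klE0 (n + 1) - klScale klE0 n)))) ((gaussConv ℂ (crossCov ℂ (softCovOf L M β μ (klFlowFrameU L M β U μ (n + 1)) (softSymbolCompl L M β μ (klFlowFrameU L M β U μ (n + 1)) (n + 1) j) + hubbardCovAboveCT L M β μ 0 (klFlowFrameU L M β U μ (n + 1)) (klScale klE0 (n + 1)) - hubbardCovAboveCT L M β μ 0 (klFlowFrameU L M β U μ (n + 1)) (klScale klE0 n + t * (klScale klE0 (n + 1) - klScale klE0 n)))) - grassmannLaplacian ℂ (crossCov ℂ (softCovOf L M β μ (klFlowFrameU L M β U μ (n + 1)) (softSymbolCompl L M β μ (klFlowFrameU L M β U μ (n + 1)) (n + 1) j) + hubbardCovAboveCT L M β μ 0 (klFlowFrameU L M β U μ (n + 1)) (klScale klE0 (n + 1)) - hubbardCovAboveCT L M β μ 0 (klFlowFrameU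 L M β U μ (n + 1)) (klScale klE0 n + t * (klScale klE0 (n + 1) - klScale klE0 n))))) (dblCopy ℂ 0 (gaussConv ℂ (softCovOf L M β μ (klFlowFrameU L M β U μ (n + 1)) (softSymbolCompl L M β μ (klFlowFrameU L M β U μ (n + 1)) (n + 1) j) + hubbardCovAboveCT L M β μ 0 (klFlowFrameU L M β U μ (n + 1)) (klScale klE0 (n + 1)) - hubbardCovAboveCT L M β μ 0 (klFlowFrameU L M β U μ (n + 1)) (klScale klE0 n + t * (klScale klE0 (n + 1) - klScale klE0 n))) (hubbardEffectiveActionCT L M β U μ 0 (klFlowFrameU L M β U μ (n + 1)) (klScale klE0 n + t * (klScale klE0 (n + 1) - klScale klE0 n)))) * dblCopy ℂ 1 (gaussConv ℂ (softCovOf L M β μ (klFlowFrameU L M β U μ (n + 1)) (softSymbolCompl L M β μ (klFlowFrameU L M β U μ (n + 1)) (n + 1) j) + hubbardCovAboveCT L M β μ 0 (klFlowFrameU L M β U μ (n + 1)) (klScale klE0 (n + 1)) - hubbardCovAboveCT L M β μ 0 (klFlowFrameU L M β U μ (n + 1)) (klScale klE0 n + t * (klScale klE0 (n + 1) - klScale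 klE0 n))) (hubbardEffectiveActionCT L M β U μ 0 (klFlowFrameU L M β U μ (n + 1)) (klScale klE0 n + t * (klScale klE0 (n + 1) - klScale klE0 n)))))))) 4 X)
    (hΦ : Φ = fun j t k => (softSymbolCompl L M β μ (klFlowFrameU L M β U μ (n + 1)) (n + 1) j) k + (hubbardCutoffWeightCT L M β μ (klFlowFrameU L M β U μ (n + 1)) (klScale klE0 (n + 1)) k - hubbardCutoffWeightCT L M β μ (klFlowFrameU L M β U μ (n + 1)) (klScale klE0 n + t * (klScale klE0 (n + 1) - klScale klE0 n)) k))
    (hWd : Wd = fun t k => deriv (fun Λ' : ℝ => hubbardCutoffWeightCT L M β μ (klFlowFrameU L M β U μ (n + 1)) Λ' k) (klScale klE0 n + t * (klScale klE0 (n + 1) - klScale klE0 n)))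
    (hBr : Br = fun j Qm t z => -(((((β * (L : ℝ) ^ 2 : ℝ) : ℂ)))⁻¹ * propCT L M β μ (klFlowFrameU L M β U μ (n + 1)) (z.2, z.1) * propCT L M β μ (klFlowFrameU L M β U μ (n + 1)) (z.2.rev, Qm - z.1)) * ((((klScale klE0 (n + 1) - klScale klE0 n) * (-Wd t (z.2, z.1) * Φ j t (z.2.rev, Qm - z.1) - Φ j t (z.2, z.1) * Wd t (z.2.rev, Qm - z.1))) : ℝ) : ℂ))
    (Tb Bar : TorusSite 2 L → TorusSite 2 L → TorusSite 2 L → ℝ)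
    (hrows : ∀ Qm : TorusSite 2 L, IsPairClassAt L Qm (n + 1) →
      ∃ (r' e₁ M4 M6 M2 W6 : ℝ) (η E₁ RH RL Wdm Wxm : TorusSite 2 L → TorusSite 2 L → ℝ), 0 ≤ r' ∧ 0 ≤ e₁ ∧
        -- a priori along the slice; history a priori [class #1]
        (∀ t ∈ Icc (0 : ℝ) 1, ∀ x y, ‖A (n + 1) Qm t x y‖ ≤ m) ∧
        (∀ x y, ‖klMemberArrayF L M β U μ n (softSymbolCompl L M β μ (klFlowFrameU L M β U μ n) n (n + 1)) Qm x y‖ ≤ m) ∧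
        -- (F)(i): majorant of the FRAME SHIFT `K_n → K_(n+1)` of the history member (model objects) + its scalar cap [k3c2-p2]
        (∀ x y, ‖((Matrix.of fun k k' : TorusSite 2 L => if k ∈ klBall L μ 0 ∧ k' ∈ klBall L μ 0 then klCovSmearedPairAmplitude L M β U μ (klFlowFrameU L M β U μ (n + 1)) n (softCovOf L M β μ (klFlowFrameU L M β U μ (n + 1)) (softSymbolCompl L M β μ (klFlowFrameU L M β U μ (n + 1)) n (n + 1))) Qm k k' else 0) - klMemberArrayF L M β U μ n (softSymbolCompl L M β μ (klFlowFrameU L M β U μ n) n (n + 1)) Qm) x y‖ ≤ η x y) ∧ (∀ x y, η x y ≤ r') ∧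
        -- smallness of the NAMED tower weight
        (3 / 2 * m + r') * ∑ p, |klSliceWeightSmeared L M β μ (klFlowFrameU L M β U μ (n + 1)) (n + 1) (fun _ => (0 : ℝ)) Qm p| ≤ 1 / 3 ∧
        -- class-#1 kernel sups along the slice (4-point / 6-point / self-energy pins of the member carrier)
        0 ≤ M4 ∧ (∀ t ∈ Icc (0 : ℝ) 1, ∀ X, ‖V (n + 1) t X‖ ≤ M4) ∧ (∀ t ∈ Icc (0 : ℝ) 1, ∀ X, ‖V6 (n + 1) t X‖ ≤ M6) ∧ (∀ t ∈ Icc (0 : ℝ) 1, ∀ p σ, ‖Sg (n + 1) t p σ‖ ≤ M2) ∧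
        -- the «≥ 2 cross lines» class row and the localisation row (hsucc's `RH₁` / `RL₁` at `j = n+1`)
        (∀ t ∈ Icc (0 : ℝ) 1, ∀ x y : TorusSite 2 L, ‖Hd (n + 1) t ![(((omega0 M, y), 0), 0), ((((omega0 M).rev, Qm - y), 1), 0), ((((omega0 M).rev, Qm - x), 1), 1), (((omega0 M, x), 0), 1)]‖ ≤ RH x y) ∧
        (∀ t ∈ Icc (0 : ℝ) 1, ∀ x y : TorusSite 2 L, ‖∑ z : TorusSite 2 L × MatsubaraIdx M, Br (n + 1) Qm t z * ((if z.1 ∈ klBall L μ 0 then V (n + 1) t ![(((omega0 M, z.1), 0), 0), ((((omega0 M).rev, Qm - z.1), 1), 0), ((((omega0 M).rev, Qm - x), 1), 1), (((omega0 M, x), 0), 1)] * V (n + 1) t ![(((omega0 M, y), 0), 0), ((((omega0 M).rev, Qm - y), 1), 0), ((((omega0 M).rev, Qm - z.1), 1), 1), (((omega0 M, z.1), 0), 1)] else 0) - V (n + 1) t ![(((z.2, z.1), 0), 0), (((z.2.rev, Qm - z.1), 1), 0), ((((omega0 M).rev, Qm - x), 1), 1), (((omega0 M, x), 0), 1)]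 * V (n + 1) t ![(((omega0 M, y), 0), 0), ((((omega0 M).rev, Qm - y), 1), 0), (((z.2.rev, Qm - z.1), 1), 1), (((z.2, z.1), 0), 1)])‖ ≤ RL x y) ∧
        -- the plain member's three WEIGHT MASSES (ph direct at transfer `x − y`, ph crossed at `x + y − Qm`, born overlap) [k3c2-p2 currency]
        (∀ t ∈ Icc (0 : ℝ) 1, ∀ x y : TorusSite 2 L, (∑ p : FreqMomentum L M, ∑ _σ : Fin 2, ∑ p' : FreqMomentum L M, if matsubaraInt M p'.1 + matsubaraInt M (omega0 M) = matsubaraInt M p.1 + matsubaraInt M (omega0 M) ∧ p'.2 = p.2 + x - y then ‖((((((Φ (n + 1) t p) : ℝ) : ℂ) * (((β * (L : ℝ) ^ 2 : ℝ) : ℂ) * propCT L M β μ (klFlowFrameU L M β U μ (n + 1)) p)) * ((((Wd t p') : ℝ) : ℂ) * (((β * (L : ℝ) ^ 2 : ℝ) : ℂ) * propCT L M β μ (klFlowFrameU L M β U μ (n + 1)) p'))) + (((((Wd t p) : ℝ) : ℂ) * (((β * (L : ℝ) ^ 2 : ℝ) : ℂ) * propCT L M β μ (klFlowFrameU L M β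 U μ (n + 1)) p)) * ((((Φ (n + 1) t p') : ℝ) : ℂ) * (((β * (L : ℝ) ^ 2 : ℝ) : ℂ) * propCT L M β μ (klFlowFrameU L M β U μ (n + 1)) p'))))‖ else 0) ≤ Wdm x y) ∧
        (∀ t ∈ Icc (0 : ℝ) 1, ∀ x y : TorusSite 2 L, (∑ p : FreqMomentum L M, ∑ p' : FreqMomentum L M, if matsubaraInt M p'.1 + matsubaraInt M (omega0 M) + matsubaraInt M (omega0 M) + 1 = matsubaraInt M p.1 ∧ p'.2 = p.2 + Qm - x - y then ‖((((((Φ (n + 1) t p) : ℝ) : ℂ) * (((β * (L : ℝ) ^ 2 : ℝ) : ℂ) * propCT L M β μ (klFlowFrameU L M β U μ (n + 1)) p)) * ((((Wd t p') : ℝ) : ℂ) * (((β * (L : ℝ) ^ 2 : ℝ) : ℂ) * propCT L M β μ (klFlowFrameU L M β U μ (n + 1)) p'))) + (((((Wd t p) : ℝ) : ℂ) * (((β * (L : ℝ) ^ 2 : ℝ) : ℂ) * propCT L M β μ (klFlowFrameU L M β U μ (n + 1)) p)) * ((((Φ (n + 1) t p') : ℝ) : ℂ) * (((β * (L : ℝ)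 ^ 2 : ℝ) : ℂ) * propCT L M β μ (klFlowFrameU L M β U μ (n + 1)) p'))))‖ else 0) ≤ Wxm x y) ∧
        (∀ t ∈ Icc (0 : ℝ) 1, (∑ p : FreqMomentum L M, ∑ _σ : Fin 2, ‖(((((Wd t p) : ℝ) : ℂ) * (((β * (L : ℝ) ^ 2 : ℝ) : ℂ) * propCT L M β μ (klFlowFrameU L M β U μ (n + 1)) p)) * ((((Φ (n + 1) t p) : ℝ) : ℂ) * (((β * (L : ℝ) ^ 2 : ℝ) : ℂ) * propCT L M β μ (klFlowFrameU L M β U μ (n + 1)) p)))‖) ≤ W6) ∧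
        -- consumer-side rows at the bar `Tb Qm` and the slot `Bar Qm`; the source majorant `FT_ρ[J] + FT_w[η]` is WRITTEN OUT
        (∀ x y, Tb Qm x y ≤ r') ∧
        (∀ x y, ((((klScale klE0 n - klScale klE0 (n + 1)) * (2⁻¹ * RH x y + ((β * (L : ℝ) ^ 2) ^ 3)⁻¹ * (M4 * M4 * Wdm x y + M4 * M4 * Wxm x y + 2 * (M6 * M2 * W6))) + RL x y) + 3 / 2 * (3 / 2 * m) * ∑ c, ((klScale klE0 n - klScale klE0 (n + 1)) * (2⁻¹ * RH x c + ((β * (L : ℝ) ^ 2) ^ 3)⁻¹ * (M4 * M4 * Wdm x c + M4 * M4 * Wxm x c + 2 * (M6 * M2 * W6))) + RL x c) * ρ (n + 1) Qm c + 3 / 2 * m * ∑ a, ρ (n + 1) Qm a * ((klScale klE0 n - klScale klE0 (n + 1)) * (2⁻¹ * RH a y + ((β * (L : ℝ) ^ 2) ^ 3)⁻¹ * (M4 * M4 * Wdm a y + M4 * M4 * Wxm a y + 2 * (M6 * M2 * W6))) + RL a y) + 9 / 4 * m * (3 / 2 * m) * ∑ a, ∑ c, ρ (n + 1) Qm a *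 ((klScale klE0 n - klScale klE0 (n + 1)) * (2⁻¹ * RH a c + ((β * (L : ℝ) ^ 2) ^ 3)⁻¹ * (M4 * M4 * Wdm a c + M4 * M4 * Wxm a c + 2 * (M6 * M2 * W6))) + RL a c) * ρ (n + 1) Qm c) +
            (η x y + 3 / 2 * (3 / 2 * m) * ∑ t, η x t * |klSliceWeightSmeared L M β μ (klFlowFrameU L M β U μ (n + 1)) (n + 1) (fun _ => (0 : ℝ)) Qm t| + 3 / 2 * (3 / 2 * m + r') * ∑ a, |klSliceWeightSmeared L M β μ (klFlowFrameU L M β U μ (n + 1)) (n + 1) (fun _ => (0 : ℝ)) Qm a| * η a y + 9 / 4 * (3 / 2 * m + r') * (3 / 2 * m) * ∑ a, ∑ t, |klSliceWeightSmeared L M β μ (klFlowFrameU L M β U μ (n + 1)) (n + 1) (fun _ => (0 : ℝ)) Qm a| * η a t * |klSliceWeightSmeared L M β μ (klFlowFrameU L M β U μ (n + 1)) (n + 1) (fun _ => (0 : ℝ)) Qm t|)) +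
          (Tb Qm x y + 3 / 2 * (3 / 2 * m) * ∑ t, Tb Qm x t * |klSliceWeightSmeared L M β μ (klFlowFrameU L M β U μ (n + 1)) (n + 1) (fun _ => (0 : ℝ)) Qm t| + 3 / 2 * (3 / 2 * m + r') * ∑ a, |klSliceWeightSmeared L M β μ (klFlowFrameU L M β U μ (n + 1)) (n + 1) (fun _ => (0 : ℝ)) Qm a| * Tb Qm a y + 9 / 4 * (3 / 2 * m + r') * (3 / 2 * m) * ∑ a, ∑ t, |klSliceWeightSmeared L M β μ (klFlowFrameU L M β U μ (n + 1)) (n + 1) (fun _ => (0 : ℝ)) Qm a| * Tb Qm a t * |klSliceWeightSmeared L M β μ (klFlowFrameU L M β U μ (n + 1)) (n + 1) (fun _ => (0 : ℝ)) Qm t|) ≤ E₁ x y) ∧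
        (∀ x y, E₁ x y ≤ e₁) ∧
        (∀ k ∈ klBall L μ 0, ∀ k' ∈ klBall L μ 0, E₁ k k' ≤ Bar Qm k k')) :
    ∀ Qm : TorusSite 2 L, IsPairClassAt L Qm (n + 1) →
      ∃ (X Nm : Matrix (TorusSite 2 L) (TorusSite 2 L) ℂ) (w₁ : TorusSite 2 L → ℝ) (Ea E₁ : TorusSite 2 L → TorusSite 2 L → ℝ) (r' e₁ : ℝ),
        0 ≤ r' ∧ 0 ≤ e₁ ∧
        (∀ x y, ¬(x ∈ klBall L μ 0 ∧ y ∈ klBall L μ 0) → X x y = 0) ∧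
        (∀ k ∈ klBall L μ 0, ∀ k' ∈ klBall L μ 0,
          X k k' = klCovSmearedPairAmplitude L M β U μ (klFlowFrameU L M β U μ n) n
            (softCovOf L M β μ (klFlowFrameU L M β U μ n) (softSymbolCompl L M β μ (klFlowFrameU L M β U μ n) n (n + 1))) Qm k k') ∧
        (∀ x y, 0 ≤ Ea x y) ∧
        (1 + Matrix.diagonal (fun p => (w₁ p : ℂ)) * X) * Nm = 1 ∧
        (∀ k ∈ klBall L μ 0, ∀ k' ∈ klBall L μ 0, ‖klPairArrayF L M β U μ (n + 1) Qm k k' - (X * Nm) k k'‖ ≤ Ea k k') ∧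
        (∀ x y, Tb Qm x y ≤ r') ∧
        (∀ x y, Ea x y + (Tb Qm x y + 3 / 2 * (3 / 2 * m) * ∑ t, Tb Qm x t * |w₁ t| + 3 / 2 * (3 / 2 * m + r') * ∑ a, |w₁ a| * Tb Qm a y +
            9 / 4 * (3 / 2 * m + r') * (3 / 2 * m) * ∑ a, ∑ t, |w₁ a| * Tb Qm a t * |w₁ t|) ≤ E₁ x y) ∧
        (∀ x y, E₁ x y ≤ e₁) ∧
        (3 / 2 * m + r') * ∑ a, |w₁ a| ≤ 1 / 3 ∧
        (∑ p, |w₁ p| ≤ 3 / 4 * G.bhi) ∧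
        (∑ p, (|w₁ p| - w₁ p) ≤ klEdge G (n + 1) (klTorusNorm L Qm)) ∧
        (∀ k ∈ klBall L μ 0, ∀ k' ∈ klBall L μ 0, E₁ k k' ≤ Bar Qm k k')  := by
  have hβ0 : 0 < β := pos_of_klBetaMin_le hβ
  -- the family member `j = n+1` IS the plain member
  have hs0 : softSymbolCompl L M β μ (klFlowFrameU L M β U μ (n + 1)) (n + 1) (n + 1) = fun _ => (0 : ℝ) := softSymbolCompl_self β μ _ (n + 1)
  refine klmt_htower_plain L M hm hK hβ hβL hG hZ (A (n + 1)) (A' (n + 1)) (b (n + 1)) (b' (n + 1))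
    (by rw [hAdef]; simp only [hs0]) (by rw [hA'def]; simp only [hs0]) (by rw [hbdef]; simp only [hs0]) (by rw [hb'def]; simp only [hs0]) Tb Bar ?_
  intro Qm hQm
  obtain ⟨r', e₁, M4, M6, M2, W6, η, E₁, RH, RL, Wdm, Wxm, hr', he₁, hAm, hXm, hη, hηe, hsm₁, hM40, hM4, hM6, hM2, hRH, hRL, hWdm, hWxm, hW6m, hTb, hE₁, hE₁e, hbar⟩ :=
    hrows Qm hQm
  clear hrows
  -- (F)(i): the start of the member curve is the re-framed history member (model object)
  have hA0 := klmf_memberCurve_zero_eq L M hZ A A' hAdef hA'def (n + 1) Qm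
  have hη' : ∀ x y, ‖(A (n + 1) Qm 0 - klMemberArrayF L M β U μ n (softSymbolCompl L M β μ (klFlowFrameU L M β U μ n) n (n + 1)) Qm) x y‖ ≤ η x y := by
    rw [hA0]; exact hη
  have hη0 : ∀ x y, 0 ≤ η x y := fun x y => (norm_nonneg _).trans (hη x y)
  -- the rate profile BY NAME and its total mass
  have hψ0 : ∀ k, 0 ≤ softSymbolCompl L M β μ (klFlowFrameU L M β U μ (n + 1)) (n + 1) (n + 1) k := fun k => by rw [hs0]
  have hVρ : ∀ c, (∫ τ in (0 : ℝ)..1, ‖b' (n + 1) Qm τ c‖) ≤ ρ (n + 1) Qm c := fun c => by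
    rw [hρdef]; beta_reduce
    exact klmf_integral_norm_rate_le_klRungProfile β μ (klFlowFrameU L M β U μ (n + 1)) hβ0 n hψ0 Qm c (fun t p => b' (n + 1) Qm t p) (by rw [hb'def])
  have hsm : 3 / 2 * m * ∑ c, ρ (n + 1) Qm c ≤ 1 / 3 := by
    have h := sum_klRungProfile_compl_le (M := M) β μ (klFlowFrameU L M β U μ (n + 1)) hK hβ hβL (le_refl (n + 1)) Qm
    rw [hρdef]; beta_reduce
    have h3 : 0 ≤ 3 / 2 * m := by positivity
    exact (mul_le_mul_of_nonneg_left h h3).trans hm7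
  -- the RESOLVED source, pointwise in `t`, in masses form
  have hΛ : 0 ≤ klScale klE0 n - klScale klE0 (n + 1) := sub_nonneg.2 (klmf_klScale_succ_pos_le n).2
  have hL0 : (0 : ℝ) < (L : ℝ) := Nat.cast_pos.mpr (Nat.pos_of_ne_zero (NeZero.ne L))
  have hc3 : 0 ≤ ((β * (L : ℝ) ^ 2) ^ 3)⁻¹ := by positivity
  have hM44 : 0 ≤ M4 * M4 := mul_nonneg hM40 hM40
  have hpt : ∀ t ∈ Icc (0 : ℝ) 1, ∀ x y,
      ‖(A' (n + 1) Qm t + A (n + 1) Qm t * diagonal (b' (n + 1) Qm t) * A (n + 1) Qm t) x y‖ ≤ ((klScale klE0 n - klScale klE0 (n + 1)) * (2⁻¹ * RH x y + ((β * (L : ℝ) ^ 2) ^ 3)⁻¹ * (M4 * M4 * Wdm x y + M4 * M4 * Wxm x y + 2 * (M6 * M2 * W6))) + RL x y) := fun t ht x y => by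
    have hM60 : 0 ≤ M6 := (norm_nonneg _).trans (hM6 t ht fun _ => (((omega0 M, x), 0), 0))
    have hM20 : 0 ≤ M2 := (norm_nonneg _).trans (hM2 t ht (omega0 M, x) 0)
    exact (klmd_defect_le_masses_family L M β U μ (klFlowFrameU L M β U μ (n + 1)) hβ0 n A A' b' hAdef hA'def hb'def V hV V6 hV6 Sg hSg Hd hHd Φ hΦ Wd hWd
      Br hBr (n + 1) Qm ht x y hM40 (hM4 t ht) (hM6 t ht) (hM2 t ht) (hRH t ht x y) (hRL t ht x y)).trans
      (klmt_masses_mono hΛ hc3 hM44 (mul_nonneg hM60 hM20) (hWdm t ht x y) (hWxm t ht x y) (hW6m t ht))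
  have hI : ∀ x y, (∫ t in (0 : ℝ)..1, ‖(A' (n + 1) Qm t + A (n + 1) Qm t * diagonal (b' (n + 1) Qm t) * A (n + 1) Qm t) x y‖) ≤ ((klScale klE0 n - klScale klE0 (n + 1)) * (2⁻¹ * RH x y + ((β * (L : ℝ) ^ 2) ^ 3)⁻¹ * (M4 * M4 * Wdm x y + M4 * M4 * Wxm x y + 2 * (M6 * M2 * W6))) + RL x y) :=
    fun x y => klmt_integral_norm_le_of_forall fun t ht => hpt t ht x y
  exact ⟨r', e₁, ρ (n + 1) Qm, η, fun x y => ((klScale klE0 n - klScale klE0 (n + 1)) * (2⁻¹ * RH x y + ((β * (L : ℝ) ^ 2) ^ 3)⁻¹ * (M4 * M4 * Wdm x y + M4 * M4 * Wxm x y + 2 * (M6 * M2 * W6))) + RL x y),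
    fun x y => (((klScale klE0 n - klScale klE0 (n + 1)) * (2⁻¹ * RH x y + ((β * (L : ℝ) ^ 2) ^ 3)⁻¹ * (M4 * M4 * Wdm x y + M4 * M4 * Wxm x y + 2 * (M6 * M2 * W6))) + RL x y) + 3 / 2 * (3 / 2 * m) * ∑ c, ((klScale klE0 n - klScale klE0 (n + 1)) * (2⁻¹ * RH x c + ((β * (L : ℝ) ^ 2) ^ 3)⁻¹ * (M4 * M4 * Wdm x c + M4 * M4 * Wxm x c + 2 * (M6 * M2 * W6))) + RL x c) * ρ (n + 1) Qm c + 3 / 2 * m * ∑ a, ρ (n + 1) Qm a * ((klScale klE0 n - klScale klE0 (n + 1)) * (2⁻¹ * RH a y + ((β * (L : ℝ) ^ 2) ^ 3)⁻¹ * (M4 * M4 * Wdm a y + M4 * M4 * Wxm a y + 2 * (M6 * M2 * W6))) + RL a y) + 9 / 4 * m * (3 / 2 * m) * ∑ a, ∑ c, ρ (n + 1) Qm a * ((klScale klE0 n - klScale klE0 (n + 1)) * (2⁻¹ * RH a c + ((β * (L : ℝ) ^ 2) ^ 3)⁻¹ * (M4 * M4 * Wdm a c + M4 * M4 * Wxm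 a c + 2 * (M6 * M2 * W6))) + RL a c) * ρ (n + 1) Qm c) +
            (η x y + 3 / 2 * (3 / 2 * m) * ∑ t, η x t * |klSliceWeightSmeared L M β μ (klFlowFrameU L M β U μ (n + 1)) (n + 1) (fun _ => (0 : ℝ)) Qm t| + 3 / 2 * (3 / 2 * m + r') * ∑ a, |klSliceWeightSmeared L M β μ (klFlowFrameU L M β U μ (n + 1)) (n + 1) (fun _ => (0 : ℝ)) Qm a| * η a y + 9 / 4 * (3 / 2 * m + r') * (3 / 2 * m) * ∑ a, ∑ t, |klSliceWeightSmeared L M β μ (klFlowFrameU L M β U μ (n + 1)) (n + 1) (fun _ => (0 : ℝ)) Qm a| * η a t * |klSliceWeightSmeared L M β μ (klFlowFrameU L M β U μ (n + 1)) (n + 1) (fun _ => (0 : ℝ)) Qm t|),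
    E₁, hr', he₁, hAm, hVρ, hsm, hXm, hη0, hη', hηe, hsm₁, hI, fun x y => le_rfl, hTb, hE₁, hE₁e, hbar⟩

end Summit.HubbardSuperconductivity.HubbardSuperconductivity.Theorems.KLRegimeSplit

end
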